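import Literature.NumberTheory.EllipticCurves.Rank1Residual.ClassX1KellerYinCertificate
import Literature.NumberTheory.EllipticCurves.Rank1Residual.ClassX1KellerYinPartner
import Literature.NumberTheory.EllipticCurves.KellerYin2024.AnomalousBSD
import HarnessLib

/-!
# Class X1: the rank-one half carries no residue of its own — it follows from Keller–Yin's display
# and `BSD(·,p)` on X1 ∩ {r = 0} at the same prime

HONEST FRAMING (cell `b2b-bsdres`, home `run/shared/lean/b2b/bsd-rank1-residual/`): the goal of the
cell is to DELETE the COMBINATION-SHAPED residual classes of the BSD formula for ALL analytic-rank
`≤ 1` curves over `ℚ` from PUBLISHED theorems only, and to TYPE what is not published; this is not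
"finishing BSD". Keller–Yin arXiv:2402.12781v2 is an UNREFEREED PREPRINT and enters only as the
explicit hypothesis `hKY_OPEN : KellerYin2024.thm421_rankOne_display_OPEN`.

`Proofs`-style file (theorems only), sequel of `ClassX1KellerYinPartner.lean` (gen 1: X1 ∩ {r = 1}
⇐ KY display + Mazur's (MC) on the WHOLE type-A locus) and `ClassX1KellerYinCertificate.lean`
(gen 2: converses of the print-shape bridges). Sharpening proved here (prover x1a, gen 2): the
partner `E^K` of a rank-`1` class-X1 curve is a RANK-ZERO curve which is either of parity type B —
then Greenberg–Vatsal 2000 Thm. 1.3 + [CGLS] Thm. 5.1.4 give its `p`-part (published) — or of type A,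
and then `(E^K, p)` is itself a class-X1 pair of analytic rank `0`. Hence:

* `pPartRankZero_twist_of_bsdp_classX1_rankZero` — the partner shape from `BSD(E',p)` on the
  rank-`0` class-X1 pairs `(E',p)` at the same prime (instead of Mazur's (MC) on all of type A);
* `bsdp_of_classX1_of_analyticRank_eq_one_of_KY_OPEN_of_bsdp_rankZero` — X1 ∩ {r = 1} (both parity
  types) ⇐ `hKY_OPEN` + `BSD(·,p)` on X1 ∩ {r = 0} + published named facts;
* `forall_bsdp_classX1_iff_forall_rankZero_of_KY_OPEN` — at a fixed prime `p`, granted `hKY_OPEN`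
  and the published facts: (`BSD(E,p)` for all class-X1 pairs at `p` with `r_an ≤ 1`) ⟺ (`BSD(E,p)`
  for all class-X1 pairs at `p` with `r_an = 0`). With x1b's kernel iff `X1.mainConjecture_iff_bsdp`
  (on X1 ∩ {r = 0}: `BSD(E,p)` ⟺ Mazur's (MC)), the cell's typed residue
  `Rank1ResidualX1Defs.MazurMainConjectureOnX1TypeA` is thus needed in RANK ZERO ONLY: the residual
  of X1 is {Keller–Yin Thms. 3.0.11 + 7.0.6 (announced)} ∪ {Mazur's (MC) at the rank-`0` type-A
  anomalous pairs (unstated in print)}, and X1b ∩ {r = 1} is not an independent item.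

## References
* T. Keller, M. Yin, arXiv:2402.12781v2 (2024), Thm. 4.2.1 and its proof (p. 22). [KellerYin2024]
* F. Castella, G. Grossi, J. Lee, C. Skinner, Invent. Math. 227 (2022), Thms. 5.1.4, 5.3.1. [CastellaEtAl2021]
* R. Greenberg, V. Vatsal, Invent. Math. 142 (2000), Thm. (1.3). [GreenbergVatsal2000]
* A. W. Knapp, *Elliptic Curves* (1992), Prop. 12.10 (twisting formula). [Knapp1993]
-/

set_option autoImplicit false

noncomputable section

open scoped Classical MatrixGroups ModularForm

open CongruenceSubgroup WeierstrassCurve Literature.NumberTheory.EllipticCurves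
  Literature.NumberTheory.EllipticCurves.ModularForms Literature.NumberTheory.QuadraticFields

namespace Literature.NumberTheory.EllipticCurves.Rank1Residual


/-- **The partner input from Greenberg–Vatsal OR from `BSD(·,p)` on the rank-zero part of X1.**
For `W/ℚ` globally minimal elliptic, a class-X1 prime `p`, an admissible field `K` (imaginary
quadratic, `d_K` odd, `p` split, `L(E^K,1) ≠ 0`) and a global minimal model `Wd` of `E^{(d_K)}`, the
rank-`0` print shape `PPartRankZero Wd p` holds, given the PUBLISHED named facts (`hGV`
Greenberg–Vatsal 2000 Thm. 1.3, `hGr` Greenberg 1999 Thm. 4.1, `hmodP`/`hmod` modularity, `hGZK`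
Gross–Zagier–Kolyvagin) and the hypothesis `h0` = Miller's `BSD(E',p)` for every class-X1 pair
`(E',p)` AT THE SAME PRIME with `ord_{s=1} L(E',s) = 0`: if `GVPar Wd p` (type B) Greenberg–Vatsal
gives Mazur's (MC) for `(Wd,p)` and [CGLS] Thm. 5.1.4 the shape (as in
`pPartRankZero_twist_of_not_gvPar`); otherwise `(Wd,p)` is itself a class-X1 pair (reducible, good,
anomalous by the twisting formula with `(d_K/p) = 1`, and `¬(r = 0 ∧ gvpar)`) of analytic rank `0`,
`h0` gives `BSDp Wd p`, and the converses `pPart_of_bsdp`, `pPartRankZero_of_pPart` return the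
shape. Compared with `pPartRankZero_twist_of_mazurMC_typeA` (`ClassX1KellerYinPartner`): the
unprinted input is asked only in RANK ZERO and in the currency `BSD(E',p)` (equivalent there to
Mazur's (MC), x1b's `X1.mainConjecture_iff_bsdp`). [cite: CastellaEtAl2021, Thm. 5.1.4 and proof of Thm. 5.3.1]
[cite: GreenbergVatsal2000, Thm. (1.3)] [cite: Knapp1993, Prop. 12.10] -/
theorem pPartRankZero_twist_of_bsdp_classX1_rankZero
    (hGV : GreenbergVatsal2000.thm13_charIdeal_eq_of_gvPar)
    (hGr : greenberg_charValue_rankZero) (hmodP : nonempty_modularParametrizationData)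
    (hmod : hasEntireLFunction_rat) (hGZK : rank_eq_analyticRank_of_analyticRank_le_one)
    (W : WeierstrassCurve ℚ) [W.IsElliptic] [W.IsGloballyMinimal] (p : ℕ) [Fact p.Prime]
    (hX1 : ClassX1 W p)
    (h0 : ∀ (W' : WeierstrassCurve ℚ) [W'.IsElliptic] [W'.IsGloballyMinimal],
      ClassX1 W' p → W'.analyticRank = 0 → BSDp W' p)
    (K : Type) [Field K] [NumberField K] (hK : IsImaginaryQuadratic K)
    (hodd : Odd (NumberField.discr K)) (hsplit : SatisfiesHeegnerHypothesis p K)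
    (hLK : (W.quadraticTwist (NumberField.discr K : ℚ)).entireLFunction 1 ≠ 0)
    (Wd : WeierstrassCurve ℚ) [Wd.IsElliptic] [Wd.IsGloballyMinimal]
    (hWd : ∃ C : VariableChange ℚ, C • Wd = W.quadraticTwist (NumberField.discr K : ℚ)) :
    PPartRankZero Wd p := by
  have hp : p.Prime := Fact.out
  have hp2 : p ≠ 2 := by have := hX1.1; omega
  have hgood : W.HasGoodReductionAtPrime p := hX1.2.2.1
  have hred : ¬ W.HasIrreducibleModPGaloisRep p := hX1.2.1
  have hanom : (p : ℤ) ∣ W.frobeniusTrace p - 1 := hX1.2.2.2.1.2.2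
  have hord : ¬ (p : ℤ) ∣ W.frobeniusTrace p :=
    KellerYin2024.not_dvd_frobeniusTrace_of_anomalous W p hanom
  obtain ⟨C, hC⟩ := hWd
  have hdneg : NumberField.discr K < 0 := IsImaginaryQuadratic.discr_neg hK
  have hd0 : (NumberField.discr K : ℚ) ≠ 0 := by exact_mod_cast hdneg.ne
  have hsqf : Squarefree (NumberField.discr K) := squarefree_discr_of_odd hK hodd
  have hpd : ¬ (p : ℤ) ∣ NumberField.discr K := not_dvd_discr_of_split hK hp hp2 hsplit
  obtain ⟨hgood_d, hord_d⟩ :=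
    isOrdinaryAt_of_smul_eq_quadraticTwist W Wd hsqf hC p hp2 hpd ⟨hgood, hord⟩
  have hLd : Wd.entireLFunction 1 ≠ 0 := by
    rw [← Wd.entireLFunction_smul C, hC]
    exact hLK
  have hrd : Wd.analyticRank = 0 := analyticRank_eq_zero_of_entireLFunction_one_ne_zero hLd
  by_cases hpar_d : GVPar Wd p
  · -- the partner is of type B: Greenberg–Vatsal + [CGLS] Thm. 5.1.4
    obtain ⟨-, hfin_d⟩ := hGZK Wd (by omega)
    exact padicValRat_bsd_rank_zero_of_mazurMainConjecture Wd p hgood_d hord_d hLd hfin_d hmodP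
      (fun κ γ hκ hγ hγ' D _ hX fE hfE hSel ↦ hGr Wd p hp2 hgood_d hord_d κ γ hκ hγ hγ' D hX fE hfE hSel)
      (hGV Wd p hp2 hgood_d hord_d hpar_d)
  · -- the partner is of type A: it is a class-X1 pair with `r_an = 0`
    have hred_d : ¬ Wd.HasIrreducibleModPGaloisRep p :=
      not_hasIrreducibleModPGaloisRep_twist hred hd0 Wd C hC
    have hanom_d : (p : ℤ) ∣ Wd.frobeniusTrace p - 1 := by
      have hj : jacobiSym (NumberField.discr K) p = 1 :=
        ((satisfiesHeegnerHypothesis_iff_kronecker p K hK.1).mp hsplit p hp dvd_rfl).2 hp2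
      have hp2d : ¬ (p : ℤ) ∣ 2 * NumberField.discr K := by
        intro h
        rcases (Nat.prime_iff_prime_int.mp hp).dvd_or_dvd h with h2 | h2
        · have := Int.le_of_dvd two_pos h2
          have h1 := hp.two_le
          have : (p : ℤ) = 2 := by omega
          exact hp2 (by exact_mod_cast this)
        · exact hpd h2
      have hΔ : ¬ (p : ℤ) ∣ W.minimalDiscriminantInt :=
        W.not_dvd_minimalDiscriminantInt_of_hasGoodReductionAtPrime' p hgood
      have htw := frobeniusTrace_quadraticTwist_holds W Wd (NumberField.discr K) hsqf ⟨C, hC⟩ p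
        hp2d hΔ
      rw [jacobiSym.legendreSym.to_jacobiSym, hj, one_mul] at htw
      rw [htw]
      exact hanom
    have hX1d : ClassX1 Wd p :=
      ⟨hX1.1, hred_d, hgood_d, ⟨hred_d, hgood_d, hanom_d⟩, fun h ↦ hpar_d h.2⟩
    exact pPartRankZero_of_pPart hGZK Wd p hrd
      (pPart_of_bsdp hmod hGZK Wd p (by omega) (h0 Wd hX1d hrd))

/-- **X1 ∩ {r = 1} ⇒ `BSD(E,p)` modulo Keller–Yin's display and `BSD(·,p)` on X1 ∩ {r = 0}.** For
`W/ℚ` globally minimal elliptic, `ClassX1 W p`, `ord_{s=1} L(E,s) = 1`: Miller's `BSD(E,p)` follows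
from the PUBLISHED named facts (`hGV` Greenberg–Vatsal 2000 Thm. 1.3, `hGr` Greenberg 1999 Thm. 4.1,
`hmodP`, `hmod` modularity, `hHL` Hoffstein–Luo 1997, `hGZ` Gross–Zagier 1986 I.7.3, `hGZK`
Gross–Zagier–Kolyvagin), the ONE open hypothesis `hKY_OPEN` (Keller–Yin's rank-one display, `∀`-form
of `KellerYin2024.thm421_rankOne_display_OPEN`; unpublished links KY Thms. 3.0.11, 7.0.6 — PREPRINT)
and `h0` — `BSD(E',p)` for the class-X1 pairs `(E',p)` of analytic rank ZERO at the same prime (the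
rank-`0` half of the typed target `BSDpOnClassX1`; ⟺ Mazur's (MC) there). So the rank-one half of
X1 — both parity types — is NOT an independent residual: it is closed by Keller–Yin's announced
theorems together with whatever closes X1 ∩ {r = 0}; on type A `h0` is not even used
(`bsdp_of_classX1_typeA_of_analyticRank_eq_one_of_KY_OPEN`).
[cite: KellerYin2024, Thm. 4.2.1 and its proof (p. 22)] [cite: CastellaEtAl2021, Thms. 5.1.4, 5.3.1] -/
theorem bsdp_of_classX1_of_analyticRank_eq_one_of_KY_OPEN_of_bsdp_rankZero
    (hGV : GreenbergVatsal2000.thm13_charIdeal_eq_of_gvPar) (hGr : greenberg_charValue_rankZero)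
    (hmodP : nonempty_modularParametrizationData) (hmod : exists_isNewformOf)
    (hHL : HoffsteinLuo1997_exists_twist_L_one_ne_zero) (hGZ : GrossZagier1986_thm_I_7_3)
    (hGZK : rank_eq_analyticRank_of_analyticRank_le_one)
    (hKY_OPEN : KellerYin2024.thm421_rankOne_display_OPEN)
    (W : WeierstrassCurve ℚ) [W.IsElliptic] [W.IsGloballyMinimal] (p : ℕ) [Fact p.Prime]
    (hX1 : ClassX1 W p) (hr : W.analyticRank = 1)
    (h0 : ∀ (W' : WeierstrassCurve ℚ) [W'.IsElliptic] [W'.IsGloballyMinimal],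
      ClassX1 W' p → W'.analyticRank = 0 → BSDp W' p) :
    BSDp W p :=
  bsdp_of_classX1_of_analyticRank_eq_one_of_KY_OPEN W p hX1 hr hmod hHL hGZ hGZK hKY_OPEN
    (fun K _ _ hK hodd _ _ hsplit hLK Wd _ _ hWd _ ↦
      pPartRankZero_twist_of_bsdp_classX1_rankZero hGV hGr hmodP
        (WeierstrassCurve.hasEntireLFunction_rat_of_exists_isNewformOf hmod) hGZK W p hX1 h0 K hK
        hodd hsplit hLK Wd hWd)

/-- **At a fixed prime, the class statement X1 is its rank-zero half plus Keller–Yin.** Granted the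
PUBLISHED named facts and Keller–Yin's rank-one display (`hKY_OPEN`, PREPRINT): `BSD(E,p)` for every
class-X1 pair at `p` with `ord_{s=1} L(E,s) ≤ 1` ⟺ `BSD(E,p)` for every class-X1 pair at `p` with
`ord_{s=1} L(E,s) = 0`. With x1b's kernel iff (`X1.mainConjecture_iff_bsdp`: on X1 ∩ {r = 0},
`BSD(E,p)` ⟺ Mazur's (MC)), the typed residue `MazurMainConjectureOnX1TypeA` of
`Rank1ResidualX1Defs` is needed in RANK ZERO ONLY. Bookkeeping over the two theorems above.
[cite: KellerYin2024, Thm. 4.2.1 and its proof (p. 22)] -/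
theorem forall_bsdp_classX1_iff_forall_rankZero_of_KY_OPEN
    (hGV : GreenbergVatsal2000.thm13_charIdeal_eq_of_gvPar) (hGr : greenberg_charValue_rankZero)
    (hmodP : nonempty_modularParametrizationData) (hmod : exists_isNewformOf)
    (hHL : HoffsteinLuo1997_exists_twist_L_one_ne_zero) (hGZ : GrossZagier1986_thm_I_7_3)
    (hGZK : rank_eq_analyticRank_of_analyticRank_le_one)
    (hKY_OPEN : KellerYin2024.thm421_rankOne_display_OPEN)
    (p : ℕ) [Fact p.Prime] :
    (∀ (W : WeierstrassCurve ℚ) [W.IsElliptic] [W.IsGloballyMinimal],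
        ClassX1 W p → W.analyticRank ≤ 1 → BSDp W p) ↔
      (∀ (W : WeierstrassCurve ℚ) [W.IsElliptic] [W.IsGloballyMinimal],
        ClassX1 W p → W.analyticRank = 0 → BSDp W p) := by
  constructor
  · intro h W _ _ hX1 hr0
    exact h W hX1 (by omega)
  · intro h0 W _ _ hX1 hr
    rcases Nat.lt_or_ge W.analyticRank 1 with hlt | hge
    · exact h0 W hX1 (by omega)
    · exact bsdp_of_classX1_of_analyticRank_eq_one_of_KY_OPEN_of_bsdp_rankZero hGV hGr hmodP hmod hHL
        hGZ hGZK hKY_OPEN W p hX1 (by omega) h0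

end Literature.NumberTheory.EllipticCurves.Rank1Residual

end
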